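import Summits.QuantumFields.BalabanUV.Beta.EriceFlowEnclosureB12AsPrintedHistoryContagionShiftFlowPicardFunctional
import Summits.QuantumFields.BalabanUV.Beta.EriceFlowEnclosureB12AsPrintedHistoryContagionShiftFlowPicardEnd

/-!
# Beta / EriceFlowEnclosureB12AsPrintedHistoryContagionShiftFlowPicardFunctionalEnd — ASYMPTOTIC FREEDOM IS CONTAGIOUS, part 17 (the functional END): on TWO
# as-printed carriers S, S′ — each with [I] THEOREM 2 AS TYPED + the binder `hrg` + NE4 + coupling-chart fading memory (θ < 1) on a box ]0, γ_u] of ANY size — whose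
# LIMIT FUNCTIONALS are η-close on the box, `|betaInf S.β u − betaInf S′.β u| ≤ η`: for every torus exponent m there are g₁₁ > 0 and K such that at EVERY renormalized
# coupling g ∈ ]0, g₁₁] and EVERY physical scale m′, **`|solution (betaInf S.β) g m′ − solution (betaInf S′.β) g m′| ≤ K·η`** — and these ARE the continuum running
# couplings of the two carriers' Theorem-2 rows (part 15): THE CONTINUUM RUNNING COUPLING DEPENDS LIPSCHITZ-CONTINUOUSLY ON THE LIMIT FUNCTIONAL, uniformly in the
# scale, near zero renormalized coupling — node U2's `T4BetaFlowWellPosed.abs_gstar_sub_gstar_le_of_betaInf_close` with NO asymptotic-freedom letter, NO floor, NO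
# `C_m γ < b(1 − θ)` (β-flow team, prover 1, unit `b2b-balaban-beta-bflow-p1`, gen 37; ROW AP-I·Uc × NODE U2; part 16 `…ShiftFlowPicardFunctional` = the abstract law)

HONEST FRAMING (page 1 of everything the β sub-cell writes): discharging `BetaPertH` makes Bałaban's UV stability UNCONDITIONAL — a
real constructive-QFT result; it is NOT the continuum limit and NOT the Clay problem.  HONEST DEPENDENCY (cell reorg 2026-08-19,
verbatim): «continuum YM on T⁴ ⇐ BetaPertH ∧ nine spine estimates (0/9 proved); BetaPertH ⇐ (D1) ∧ (D4) ∧ CAP+tail; G-an2-4 gates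
asym, D1 and NE2/3/4.»  THIS MODULE DISCHARGES NOTHING: a junction BY NAME of part 16 (`abs_solution_sub_le_of_functional_close`) with part 15 (`reference_of_typedTheorem2`,
`solution_eq_gstar_of_typedTheorem2`), part 11 (`flow_threshold_exists`) and node U2's `T4BetaStationary.memoryProfile_betaInf`, over the NAMED FIELDS of `B12BetaAsPrinted`
([I] = T. Bałaban, Commun. Math. Phys. **109** (1987) [Balaban1987RG1]): `Theorem2Statement S hL`, `Theorem2Statement S′ hL′` (Theorem 2 AS TYPED — STATED WITHOUT PROOF in
print, p. 259; HYPOTHESES), the binders `hrg`, `hrg′` ((0.20) along in-box rows).  The LETTERS `ScaleShiftRate` (NE4; NOT PRINTED, GAPS G-t4-U2-1) and `HistLipschitz` ∕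
`FadingMemory` (NOT PRINTED, GAPS G-t4-U2-2) are hypotheses on the abstract families `S.β`, `S′.β`; the η-closeness of the two limit functionals is a HYPOTHESIS relating two
abstract carriers; NOTHING is asserted about Bałaban's β.  «Continuum running coupling» = the K → ∞ limit of the effective couplings of (0.20) at fixed physical scale, NOT the
continuum limit of the measures.

WHAT THIS FILE PROVES (0 sorry, 0 def): **`solution_lipschitz_functional_of_typedTheorem2`** (∀ m ∃ g₁₁ > 0, K ≥ 0 ∀ η ∀ (η-closeness on the box) ∀ g ∈ ]0, g₁₁] ∀ m′:
`|solution (betaInf S.β) g m′ − solution (betaInf S′.β) g m′| ≤ K·η`), **`gstar_lipschitz_functional_of_typedTheorem2`** (the same for the continuum running couplings `gstar` of ANY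
two families of Theorem-2-type rows of S and of S′ pinned at the same g).  NOT CLAIMED: anything about Bałaban's β; Theorem 2; `BetaPertH`; the continuum limit of the
measures; Clay.
-/

namespace Summit.QuantumFields.BalabanUV.Beta.EriceFlowEnclosureB12AsPrintedHistoryContagionShiftFlowPicardFunctionalEnd

open Finset Filter Topology
open Literature.MathematicalPhysics.QuantumFieldTheory.Balaban1983to89
open Literature.MathematicalPhysics.QuantumFieldTheory.Balaban1983to89.B12BetaAsPrinted
open Literature.MathematicalPhysics.QuantumFieldTheory.Balaban1983to89.FlowStep (RGEqH)
open Literature.MathematicalPhysics.QuantumFieldTheory.Balaban1983to89.T4CouplingMatching (HistLipschitz FadingMemory ScaleShiftRate disc)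
open Literature.MathematicalPhysics.QuantumFieldTheory.Balaban1983to89.T4ContinuumCoupling (gstar)
open Literature.MathematicalPhysics.QuantumFieldTheory.Balaban1983to89.T4BetaStationary (SeqBox betaInf memoryProfile_betaInf)
open Literature.MathematicalPhysics.QuantumFieldTheory.Balaban1983to89.T4BetaFlowWellPosed (MemFlow iterate solution)
open Summit.QuantumFields.BalabanUV.Beta.EriceFlowEnclosureB12AsPrintedHistoryContagionShiftFlowEnd (flow_threshold_exists)
open Summit.QuantumFields.BalabanUV.Beta.EriceFlowEnclosureB12AsPrintedHistoryContagionShiftFlowPicardFunctional (abs_solution_sub_le_of_functional_close)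
open Summit.QuantumFields.BalabanUV.Beta.EriceFlowEnclosureB12AsPrintedHistoryContagionShiftFlowPicardEnd (reference_of_typedTheorem2
  solution_eq_gstar_of_typedTheorem2)

noncomputable section

variable {S S' : Setting}

/-- **THE CONTINUUM RUNNING COUPLING IS LIPSCHITZ IN THE LIMIT FUNCTIONAL — FROM THEOREM 2 AS TYPED ON TWO CARRIERS.**  Carriers S, S′ with `Theorem2Statement` AS TYPED
(HYPOTHESES), binders `hrg`, `hrg′` on ]0, γ_u], NE4 `ScaleShiftRate c θ γ_u` and moduli `HistLipschitz Λ γ_u` ∕ `HistLipschitz Λ′ γ_u` with `FadingMemory C θ Λ`,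
`FadingMemory C θ Λ′` (0 < θ < 1, C ≥ 0, c ≥ 0; γ_u ARBITRARY).  THEN for every torus exponent m there are g₁₁ > 0 and K ≥ 0 such that for EVERY η, if the limit functionals
are η-close on the box (`|betaInf S.β u − betaInf S′.β u| ≤ η` for all box-valued u), then at every g ∈ ]0, g₁₁] and every physical scale m′:
**`|solution (betaInf S.β) g m′ − solution (betaInf S′.β) g m′| ≤ K·η`** (K = (32∕3)g₁₁(g₁₁² + 1∕min(b, b′)) from the two references' rates).  Node U2's
`abs_gstar_sub_gstar_le_of_betaInf_close` (there: `(γ∕b)η∕(1−q)` under the floor and `C_m γ < b(1−θ)`) floor-free near zero renormalized coupling.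
[cite: Balaban1987RG1, Thm 2 (0.31) p.259 with (0.20) p.256 and §5 p.298] -/
theorem solution_lipschitz_functional_of_typedTheorem2 {hL : Odd S.L ∧ 1 < S.L} (h : Theorem2Statement S hL)
    {hL' : Odd S'.L ∧ 1 < S'.L} (h' : Theorem2Statement S' hL')
    {γu θ C c : ℝ} {Λ Λ' : ℕ → ℕ → ℝ} (hγu : 0 < γu)
    (hrg : ∀ P : B12.RunParams, Step.InInterval γu P.K (S.cpl P) → RGEqH P.K S.β (S.cpl P))
    (hrg' : ∀ P : B12.RunParams, Step.InInterval γu P.K (S'.cpl P) → RGEqH P.K S'.β (S'.cpl P))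
    (hS : ScaleShiftRate c θ γu S.β) (hS' : ScaleShiftRate c θ γu S'.β)
    (hLm : HistLipschitz Λ γu S.β) (hLm' : HistLipschitz Λ' γu S'.β) (hΛ : FadingMemory C θ Λ) (hΛ' : FadingMemory C θ Λ')
    (hθ0 : 0 < θ) (hθ1 : θ < 1) (hC : 0 ≤ C) (hc : 0 ≤ c) (m : ℕ) :
    ∃ g₁₁ K : ℝ, 0 < g₁₁ ∧ 0 ≤ K ∧ ∀ η : ℝ, (∀ u : ℕ → ℝ, SeqBox γu u → |betaInf S.β u - betaInf S'.β u| ≤ η) →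
      ∀ e : ℝ, 0 < e → e ≤ g₁₁ → ∀ m' : ℕ, |solution (betaInf S.β) e m' - solution (betaInf S'.β) e m'| ≤ K * η := by
  have h1θ : 0 < 1 - θ := by linarith
  have hB := memoryProfile_betaInf hS hLm hΛ hθ0.le hθ1
  have hB' := memoryProfile_betaInf hS' hLm' hΛ' hθ0.le hθ1
  obtain ⟨gr, b, -, -, t, hgr, hb, -, -, htbox, htflow, hprof, -, -⟩ := reference_of_typedTheorem2 h hγu hrg hS hLm hΛ hθ0 hθ1 hC hc m
  obtain ⟨gr', b', -, -, t', hgr', hb', -, -, htbox', htflow', hprof', -, -⟩ := reference_of_typedTheorem2 h' hγu hrg' hS' hLm' hΛ' hθ0 hθ1 hC hc m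
  have h2gr : 0 < 2 * gr := by positivity
  have h2gr' : 0 < 2 * gr' := by positivity
  have hb0 : 0 < min b b' := lt_min hb hb'
  obtain ⟨e₀, he₀, hthr⟩ := flow_threshold_exists (1 / gr ^ 2 + C * γu / (1 - θ) ^ 2 + (2 * C / ((1 - θ) * b)) ^ 2) hC hθ1 hb
  obtain ⟨e₀', he₀', hthr'⟩ := flow_threshold_exists (1 / gr' ^ 2 + C * γu / (1 - θ) ^ 2 + (2 * C / ((1 - θ) * b')) ^ 2) hC hθ1 hb'
  -- the extra smallness `C(8e³ + 16e∕min(b,b′)) ≤ (1−θ)²∕4` below e₁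
  set e₁ : ℝ := min 1 ((1 - θ) ^ 2 / (4 * (C * (8 + 16 / min b b')) + 1)) with he₁
  have he₁0 : 0 < e₁ := lt_min one_pos (by positivity)
  have hs6 : ∀ e : ℝ, 0 < e → e ≤ e₁ → C * (8 * e ^ 3 + 16 * e / min b b') ≤ (1 - θ) ^ 2 / 4 := by
    intro e he hle
    have hle1 : e ≤ 1 := hle.trans (min_le_left _ _)
    have hle' : e ≤ (1 - θ) ^ 2 / (4 * (C * (8 + 16 / min b b')) + 1) := hle.trans (min_le_right _ _)
    rw [le_div_iff₀ (by positivity)] at hle'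
    have he3 : e ^ 3 ≤ e := by nlinarith [mul_le_mul hle1 hle1 he.le zero_le_one]
    have hK : 0 ≤ C * (8 + 16 / min b b') := by positivity
    calc C * (8 * e ^ 3 + 16 * e / min b b') ≤ C * (8 * e + 16 * e / min b b') := by gcongr
      _ = e * (C * (8 + 16 / min b b')) := by ring
      _ ≤ (1 - θ) ^ 2 / 4 := by nlinarith
  set g₁₁ : ℝ := min (min e₀ e₀') (min (γu / 2) e₁) with hg₁₁
  have hg₁₁0 : 0 < g₁₁ := lt_min (lt_min he₀ he₀') (lt_min (by positivity) he₁0)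
  refine ⟨g₁₁, 32 / 3 * g₁₁ * (g₁₁ ^ 2 + 1 / min b b'), hg₁₁0, by positivity, fun η hη e he hle m' => ?_⟩
  obtain ⟨hs1, hs2, hs4⟩ := hthr e he (hle.trans ((min_le_left _ _).trans (min_le_left _ _)))
  obtain ⟨hs1', hs2', -⟩ := hthr' e he (hle.trans ((min_le_left _ _).trans (min_le_right _ _)))
  have h2e : 2 * e ≤ γu := by linarith [hle.trans ((min_le_right _ _).trans (min_le_left _ _))]
  have hs6e := hs6 e he (hle.trans ((min_le_right _ _).trans (min_le_right _ _)))
  have hk := abs_solution_sub_le_of_functional_close hB hB' hC hθ0.le hθ1 hb h2gr htbox htflow hprof hb' h2gr' htbox' htflow' hprof'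
    hη he h2e hs1 hs2 hs1' hs2' hs4 hs6e m'
  have hη0 : 0 ≤ η := (abs_nonneg _).trans (hη t htbox)
  have hmono : 32 / 3 * e * (e ^ 2 + 1 / min b b') ≤ 32 / 3 * g₁₁ * (g₁₁ ^ 2 + 1 / min b b') := by
    have h1 : e ^ 2 ≤ g₁₁ ^ 2 := pow_le_pow_left₀ he.le hle 2
    have h2 : 0 ≤ e ^ 2 + 1 / min b b' := by positivity
    calc 32 / 3 * e * (e ^ 2 + 1 / min b b') ≤ 32 / 3 * g₁₁ * (e ^ 2 + 1 / min b b') := by nlinarith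
      _ ≤ 32 / 3 * g₁₁ * (g₁₁ ^ 2 + 1 / min b b') := by nlinarith
  exact hk.trans (mul_le_mul_of_nonneg_right hmono hη0)

/-- **… AND SO ARE THE CONTINUUM RUNNING COUPLINGS OF THE TWO CARRIERS' THEOREM-2 ROWS**: under the data of `solution_lipschitz_functional_of_typedTheorem2`, for every m there
are g₁₂ > 0 and K ≥ 0 such that for every η-closeness of the limit functionals, every g ∈ ]0, g₁₂] and ANY two families of Theorem-2-type rows of S and of S′ in ]0, γ_u]
pinned at g: `|gstar rows m′ − gstar rows′ m′| ≤ K·η` at every physical scale m′ (part 15: both are node U2's lattice-free `solution`s).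
[cite: Balaban1987RG1, Thm 2 (0.31) p.259 with (0.20) p.256 and §5 p.298] -/
theorem gstar_lipschitz_functional_of_typedTheorem2 {hL : Odd S.L ∧ 1 < S.L} (h : Theorem2Statement S hL)
    {hL' : Odd S'.L ∧ 1 < S'.L} (h' : Theorem2Statement S' hL')
    {γu θ C c : ℝ} {Λ Λ' : ℕ → ℕ → ℝ} (hγu : 0 < γu)
    (hrg : ∀ P : B12.RunParams, Step.InInterval γu P.K (S.cpl P) → RGEqH P.K S.β (S.cpl P))
    (hrg' : ∀ P : B12.RunParams, Step.InInterval γu P.K (S'.cpl P) → RGEqH P.K S'.β (S'.cpl P))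
    (hS : ScaleShiftRate c θ γu S.β) (hS' : ScaleShiftRate c θ γu S'.β)
    (hLm : HistLipschitz Λ γu S.β) (hLm' : HistLipschitz Λ' γu S'.β) (hΛ : FadingMemory C θ Λ) (hΛ' : FadingMemory C θ Λ')
    (hθ0 : 0 < θ) (hθ1 : θ < 1) (hC : 0 ≤ C) (hc : 0 ≤ c) (m : ℕ) :
    ∃ g₁₂ K : ℝ, 0 < g₁₂ ∧ 0 ≤ K ∧ ∀ η : ℝ, (∀ u : ℕ → ℝ, SeqBox γu u → |betaInf S.β u - betaInf S'.β u| ≤ η) →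
      ∀ (e : ℝ) (g g' : ℕ → ℕ → ℝ), 0 < e → e ≤ g₁₂ →
      (∀ K, ∃ (m' : ℕ) (g₀ : ℝ), g K = S.cpl ⟨K, m', g₀⟩) → (∀ K, Step.InInterval γu K (g K)) → (∀ K, g K K = e) →
      (∀ K, ∃ (m' : ℕ) (g₀ : ℝ), g' K = S'.cpl ⟨K, m', g₀⟩) → (∀ K, Step.InInterval γu K (g' K)) → (∀ K, g' K K = e) →
      ∀ m' : ℕ, |gstar g m' - gstar g' m'| ≤ K * η := by
  obtain ⟨g₁₁, K, hg₁₁, hK, hmain⟩ :=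
    solution_lipschitz_functional_of_typedTheorem2 h h' hγu hrg hrg' hS hS' hLm hLm' hΛ hΛ' hθ0 hθ1 hC hc m
  obtain ⟨g₉, hg₉, hsol⟩ := solution_eq_gstar_of_typedTheorem2 h hγu hrg hS hLm hΛ hθ0 hθ1 hC hc m
  obtain ⟨g₉', hg₉', hsol'⟩ := solution_eq_gstar_of_typedTheorem2 h' hγu hrg' hS' hLm' hΛ' hθ0 hθ1 hC hc m
  refine ⟨min g₁₁ (min g₉ g₉'), K, lt_min hg₁₁ (lt_min hg₉ hg₉'), hK,
    fun η hη e g g' he hle hrow hI hpin hrow' hI' hpin' m' => ?_⟩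
  obtain ⟨-, -, -, hgs, -⟩ := hsol e he (hle.trans ((min_le_right _ _).trans (min_le_left _ _)))
  obtain ⟨-, -, -, hgs', -⟩ := hsol' e he (hle.trans ((min_le_right _ _).trans (min_le_right _ _)))
  rw [hgs g hrow hI hpin, hgs' g' hrow' hI' hpin']
  exact hmain η hη e he (hle.trans (min_le_left _ _)) m'

end

end Summit.QuantumFields.BalabanUV.Beta.EriceFlowEnclosureB12AsPrintedHistoryContagionShiftFlowPicardFunctionalEnd
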